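import Mathlib.NumberTheory.FLT.Basic
import Mathlib.NumberTheory.Multiplicity
import Mathlib.NumberTheory.Padics.PadicVal.Basic
import Mathlib.Algebra.GCDMonoid.Basic
import Mathlib.Algebra.GCDMonoid.Nat
import Mathlib.FieldTheory.Finite.Basic
import Mathlib.Analysis.SpecialFunctions.Pow.Real
import Mathlib.Analysis.Complex.ExponentialBounds
import HarnessLib

/-!
# [ExpEst] §5, Lemmas 5.5 and 5.6 (elementary properties of possible solutions of the Fermat equation) — PROVED

S. Mochizuki, I. Fesenko, Y. Hoshi, A. Minamide, W. Porowski, *Explicit estimates in inter-universal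
Teichmüller theory*, Kodai Math. J. **45** (2022) 175–236 (= [ExpEst]), §5, **Lemma 5.5** (p. 225) and
**Lemma 5.6** (pp. 225–227) (render `plan/repair/lit/renders/MFHMP-ExplicitEstimates-Kodai2022-book-anonnd-eeiutp`,
pdf p. 51 l.17 – p. 53 l.4; pdf page = journal page − 174). These are the "various estimates of an entirely
elementary nature" (Introduction p. 179) through which the paper derives Corollary 5.8 ("FLT for prime
exponents `> 1.615·10^14`") from Theorem 5.3; the companion file `ExplicitEstimatesFermat.lean` proves
Lemma 5.7 (`z > (p+1)^p/2`) and the implication [disputed Thm B] ⟹ Cor. 5.8 from them. Everything here is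
CLASSICAL, UNDISPUTED and PROVED; the bibliographic key `MochizukiEtAl2022` carries the D-0012 claim status
(the paper's §5 main results depend on [IUTchIII] Cor. 3.12), hence the tag form. No named fact is introduced.

**Lemma 5.5 as printed.** "Let `p ≥ 3` be an odd integer; `r, s` integers such that `r + s ≠ 0`. Then we have
`(r^p + s^p)(r + s)⁻¹ = p s^{p−1} − (r + s) Σ_{i=0}^{p−2} (−1)^{i+1}(i+1) r^{p−2−i} s^i`."
*Typed:* the integer `(r^p + s^p)(r + s)⁻¹` is the closed form `powSumQuot p r s = Σ_{i<p} r^i (−s)^{p−1−i}`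
(`powSumQuot_mul_add`: `Q·(r + s) = r^p + s^p`; `powSumQuot_eq_div`), and Lemma 5.5 is recorded in the form
in which Lemmas 5.6/5.7 invoke it ("it follows from Lemma 5.5 that `l` divides `p s^{p−1}`"): `r + s ∣ Q − p·s^{p−1}`
(`lemma55_dvd`). WEAKER than print as a formula (first order in `r + s` only); the printed second-order identity
has no user here and is not typed.

**Lemma 5.6 as printed.** "Let `p ≥ 3` be a prime number; `r, s, t` nonzero coprime integers such that
`r^p + s^p + t^p = 0`. Then the following hold: (i) Let `l` be a prime number which divides `r + s`,
`(r^p + s^p)(r + s)⁻¹ ∈ ℤ`. Then it holds that `l = p`. (ii) Suppose that `p` does not divide `t`. Then `r + s` and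
`(r^p + s^p)(r + s)⁻¹` are coprime. In particular, [since `(r + s)·(r^p + s^p)(r + s)⁻¹ = (−t)^p`] there exist
integers `u` and `ũ` such that `r + s = u^p`; `(r^p + s^p)(r + s)⁻¹ = ũ^p`; `t = −uũ`. (iii) Suppose that `p`
divides `t`. Then it holds that `r + s ∈ pℤ`; `(r^p + s^p)(r + s)⁻¹ ∈ pℤ ∖ p²ℤ`. In particular, if we write
`t = p^κ v` … there exist integers `w ∉ pℤ` and `w̃ ∉ pℤ` such that `r + s = p^{κp−1} w^p`;
`(r^p + s^p)(r + s)⁻¹ = p w̃^p`; `v = −w w̃`."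
*Typed and PROVED:* `lemma56_i`, `lemma56_ii`, `lemma56_iii` with the hypothesis "coprime" rendered as
`IsCoprime r s` (pairwise coprimality of `r, s`; for a Fermat triple this is equivalent to print's "no common
factor of `r, s, t`", cf. Mathlib's `isCoprime_of_gcd_eq_one_of_FLT`), and `p` any odd prime. (i) needs neither
`t` nor the equation. (iii)'s "in particular" clause is not typed (no user: Lemma 5.7's case `p ∣ z` is closed
in the companion file by the lifting-the-exponent lemma directly). Kernel routes: (i)/(ii) as printed
(Lemma 5.5 + unique factorisation: Mathlib's `exists_associated_pow_of_mul_eq_pow`); (iii) "`∉ p²ℤ`" by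
Mathlib's lifting-the-exponent lemma `Int.emultiplicity_pow_add_pow` in place of the binomial expansion of
Claim 5.6A (same content: `v_p((r^p + s^p)/(r + s)) = 1`).

Also PROVED here for the companion file: `odd_geom_sum₂` (a sum of an odd number of odd terms
`u^i v^{n−1−i}` is odd — "each term `b^{p−i−1}c^i` is odd", proof of Lemma 5.7 p. 228) and
`succ_pow_lt_pow` (`(p+1)^p < p^{2p−1}` for `p ≥ 3` — "`γ^{2γ−1} > (γ+1)^γ` for all `γ ∈ ℝ_{≥3}`", p. 229).

## References
* [MochizukiEtAl2022] Kodai Math. J. 45 (2022) 175–236, Lemmas 5.5, 5.6 (pp. 225–227) [claim key, D-0012;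
  these lemmas are classical].
-/

namespace Literature.IUT.LogVolume

namespace ExpEst

open Finset

/-! ### The quotient `(r^p + s^p)/(r + s)` -/

/-- The integer `(r^p + s^p)·(r + s)⁻¹` of [ExpEst] Lemmas 5.5–5.7 (for `p` odd, `r + s ≠ 0`), given by the
closed form `Σ_{i<p} r^i (−s)^{p−1−i}` (so that no division occurs; `powSumQuot_mul_add`,
`powSumQuot_eq_div`). [cite: MochizukiEtAl2022, Lemma 5.5 p. 225] -/
def powSumQuot (p : ℕ) (r s : ℤ) : ℤ := ∑ i ∈ Finset.range p, r ^ i * (-s) ^ (p - 1 - i)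

variable {p : ℕ}

/-- `Q(r,s)·(r + s) = r^p + s^p` for odd `p`. [cite: MochizukiEtAl2022, Lemma 5.5 p. 225] -/
theorem powSumQuot_mul_add (hp : Odd p) (r s : ℤ) : powSumQuot p r s * (r + s) = r ^ p + s ^ p := by
  have h := geom_sum₂_mul r (-s) p
  rw [sub_neg_eq_add, hp.neg_pow, sub_neg_eq_add] at h
  exact h

/-- `Q(r,s) = (r^p + s^p)/(r + s)` when `r + s ≠ 0` (odd `p`). [cite: MochizukiEtAl2022, Lemma 5.5 p. 225] -/
theorem powSumQuot_eq_div (hp : Odd p) {r s : ℤ} (h : r + s ≠ 0) :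
    powSumQuot p r s = (r ^ p + s ^ p) / (r + s) := by
  rw [← powSumQuot_mul_add hp r s, Int.mul_ediv_cancel _ h]

/-- **[ExpEst] Lemma 5.5** (p. 225), reduced modulo `r + s`: "`(r^p + s^p)(r + s)⁻¹ = p·s^{p−1} − (r + s)·
Σ_{i=0}^{p−2} (−1)^{i+1}(i+1) r^{p−2−i} s^i`" — typed in the form in which Lemmas 5.6, 5.7 use it:
`r + s` divides `(r^p + s^p)(r + s)⁻¹ − p·s^{p−1}` (odd `p`). PROVED (each term `r^i(−s)^{p−1−i} ≡ (−s)^{p−1} =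
s^{p−1}` modulo `r + s`). The exact second-order identity is not typed (no user). [cite: MochizukiEtAl2022, Lemma 5.5 p. 225] -/
theorem lemma55_dvd (hp : Odd p) (r s : ℤ) : r + s ∣ powSumQuot p r s - p * s ^ (p - 1) := by
  have hev : Even (p - 1) := by
    obtain ⟨k, rfl⟩ := hp; exact ⟨k, by omega⟩
  have hconst : (p : ℤ) * s ^ (p - 1) = ∑ i ∈ Finset.range p, (-s) ^ i * (-s) ^ (p - 1 - i) := by
    rw [Finset.sum_congr rfl (fun i hi => by
      rw [← pow_add, Nat.add_sub_cancel' (by have := Finset.mem_range.mp hi; omega)])]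
    rw [Finset.sum_const, Finset.card_range, nsmul_eq_mul, hev.neg_pow]
  rw [powSumQuot, hconst, ← Finset.sum_sub_distrib]
  refine Finset.dvd_sum fun i _ => ?_
  rw [← sub_mul]
  refine Dvd.dvd.mul_right ?_ _
  have h := sub_dvd_pow_sub_pow r (-s) i
  rwa [sub_neg_eq_add] at h

/-! ### Lemma 5.6 -/

/-- **[ExpEst] Lemma 5.6 (i)** (p. 226): "Let `p ≥ 3` be a prime number; `r, s, t` nonzero coprime integers such
that `r^p + s^p + t^p = 0`. (i) Let `l` be a prime number which divides `r + s`, `(r^p + s^p)(r + s)⁻¹ ∈ ℤ`. Then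
it holds that `l = p`." PROVED, for any odd prime `p` and any coprime `r, s` (the third variable and the equation
are not needed for (i)): by Lemma 5.5, `l ∣ p·s^{p−1}`, and `l ∣ s` would force `l ∣ r`.
[cite: MochizukiEtAl2022, Lemma 5.6 (i) p. 226] -/
theorem lemma56_i (hp : p.Prime) (hodd : Odd p) {r s : ℤ} (hrs : IsCoprime r s) {l : ℕ} (hl : l.Prime)
    (hl1 : (l : ℤ) ∣ r + s) (hl2 : (l : ℤ) ∣ powSumQuot p r s) : l = p := by
  have hlP : Prime (l : ℤ) := Nat.prime_iff_prime_int.mp hl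
  have h3 : (l : ℤ) ∣ (p : ℤ) * s ^ (p - 1) := by
    have := dvd_sub hl2 (dvd_trans hl1 (lemma55_dvd hodd r s))
    simpa using this
  rcases hlP.dvd_or_dvd h3 with h | h
  · exact (Nat.prime_dvd_prime_iff_eq hl hp).mp (Int.natCast_dvd_natCast.mp h)
  · exfalso
    have hs : (l : ℤ) ∣ s := hlP.dvd_of_dvd_pow h
    have hr : (l : ℤ) ∣ r := by
      have := dvd_sub hl1 hs
      simpa using this
    exact hlP.not_unit (hrs.isUnit_of_dvd' hr hs)

/-- In the situation of Lemma 5.6: `r + s ≠ 0`. [cite: MochizukiEtAl2022, Lemma 5.6 p. 225] -/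
theorem add_ne_zero_of_fermat (hodd : Odd p) {r s t : ℤ} (ht : t ≠ 0)
    (heq : r ^ p + s ^ p + t ^ p = 0) : r + s ≠ 0 := by
  intro h0
  have h1 : r ^ p + s ^ p = 0 := by
    rw [← powSumQuot_mul_add hodd r s, h0, mul_zero]
  have : t ^ p = 0 := by linarith
  exact ht (pow_eq_zero_iff (hodd.pos.ne') |>.mp this)

/-- `(r + s)·Q(r,s) = (−t)^p` in the situation of Lemma 5.6. [cite: MochizukiEtAl2022, Lemma 5.6 p. 226] -/
theorem add_mul_powSumQuot_eq (hodd : Odd p) {r s t : ℤ} (heq : r ^ p + s ^ p + t ^ p = 0) :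
    (r + s) * powSumQuot p r s = (-t) ^ p := by
  rw [mul_comm, powSumQuot_mul_add hodd, hodd.neg_pow]
  linarith

/-- **[ExpEst] Lemma 5.6 (ii)** (p. 226): "Suppose that `p` does not divide `t`. Then `r + s` and
`(r^p + s^p)(r + s)⁻¹` are coprime. In particular, [since `(r + s)·(r^p + s^p)(r + s)⁻¹ = (−t)^p`] there exist
integers `u` and `ũ` such that `r + s = u^p`, `(r^p + s^p)(r + s)⁻¹ = ũ^p`, `t = −uũ`." PROVED (hypotheses:
`p` an odd prime, `r, s` coprime, `r^p + s^p + t^p = 0`, `p ∤ t`). [cite: MochizukiEtAl2022, Lemma 5.6 (ii) p. 226] -/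
theorem lemma56_ii (hp : p.Prime) (hodd : Odd p) {r s t : ℤ} (hrs : IsCoprime r s)
    (heq : r ^ p + s ^ p + t ^ p = 0) (hpt : ¬ (p : ℤ) ∣ t) :
    IsCoprime (r + s) (powSumQuot p r s) ∧
      ∃ u v : ℤ, r + s = u ^ p ∧ powSumQuot p r s = v ^ p ∧ t = -(u * v) := by
  have hprod := add_mul_powSumQuot_eq hodd heq
  -- coprimality
  have hcop : IsCoprime (r + s) (powSumQuot p r s) := by
    rw [Int.isCoprime_iff_gcd_eq_one]
    by_contra hg
    obtain ⟨l, hl, hlg⟩ := Nat.exists_prime_and_dvd hg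
    have hl1 : (l : ℤ) ∣ r + s := dvd_trans (Int.natCast_dvd_natCast.mpr hlg) (Int.gcd_dvd_left ..)
    have hl2 : (l : ℤ) ∣ powSumQuot p r s :=
      dvd_trans (Int.natCast_dvd_natCast.mpr hlg) (Int.gcd_dvd_right ..)
    have hlp : l = p := lemma56_i hp hodd hrs hl hl1 hl2
    subst hlp
    apply hpt
    have hP : Prime (l : ℤ) := Nat.prime_iff_prime_int.mp hp
    have : (l : ℤ) ∣ (-t) ^ l := hprod ▸ dvd_mul_of_dvd_left hl1 _
    exact (dvd_neg).mp (hP.dvd_of_dvd_pow this)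
  refine ⟨hcop, ?_⟩
  -- `p`-th powers
  have hunit : IsUnit (gcd (r + s) (powSumQuot p r s)) := by
    rw [← Int.coe_gcd, Int.isCoprime_iff_gcd_eq_one.mp hcop]; simp
  have hunit' : IsUnit (gcd (powSumQuot p r s) (r + s)) := by
    rw [gcd_comm]; exact hunit
  obtain ⟨d, hd⟩ := exists_associated_pow_of_mul_eq_pow hunit hprod
  obtain ⟨e, he⟩ := exists_associated_pow_of_mul_eq_pow hunit' (by rw [mul_comm]; exact hprod)
  obtain ⟨u, hu⟩ : ∃ u : ℤ, r + s = u ^ p := by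
    rcases Int.associated_iff.mp hd with h | h
    · exact ⟨d, h.symm⟩
    · exact ⟨-d, by rw [hodd.neg_pow]; linarith⟩
  obtain ⟨v, hv⟩ : ∃ v : ℤ, powSumQuot p r s = v ^ p := by
    rcases Int.associated_iff.mp he with h | h
    · exact ⟨e, h.symm⟩
    · exact ⟨-e, by rw [hodd.neg_pow]; linarith⟩
  refine ⟨u, v, hu, hv, ?_⟩
  have h1 : t ^ p = (-(u * v)) ^ p := by
    rw [hodd.neg_pow, mul_pow, ← hu, ← hv, hprod, hodd.neg_pow, neg_neg]
  exact (hodd.strictMono_pow (R := ℤ)).injective h1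

/-- **[ExpEst] Lemma 5.6 (iii)** (p. 226): "Suppose that `p` divides `t`. Then it holds that `r + s ∈ pℤ`,
`(r^p + s^p)(r + s)⁻¹ ∈ pℤ ∖ p²ℤ`." PROVED (hypotheses: `p` an odd prime, `r, s` coprime, `t ≠ 0`,
`r^p + s^p + t^p = 0`, `p ∣ t`; the kernel route for "`∉ p²ℤ`" is the lifting-the-exponent lemma, Mathlib's
`Int.emultiplicity_pow_add_pow`, in place of the printed binomial expansion of Claim 5.6A). The printed
"in particular" (`r + s = p^{κp−1} w^p`, …) is not typed. [cite: MochizukiEtAl2022, Lemma 5.6 (iii) p. 226] -/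
theorem lemma56_iii (hp : p.Prime) (hodd : Odd p) {r s t : ℤ} (hrs : IsCoprime r s) (ht : t ≠ 0)
    (heq : r ^ p + s ^ p + t ^ p = 0) (hpt : (p : ℤ) ∣ t) :
    (p : ℤ) ∣ r + s ∧ (p : ℤ) ∣ powSumQuot p r s ∧ ¬ (p : ℤ) ^ 2 ∣ powSumQuot p r s := by
  haveI : Fact p.Prime := ⟨hp⟩
  have hP : Prime (p : ℤ) := Nat.prime_iff_prime_int.mp hp
  have hne := add_ne_zero_of_fermat hodd ht heq
  have hprod := add_mul_powSumQuot_eq hodd heq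
  -- `r + s ≡ (r + s)^p ≡ r^p + s^p = −t^p ≡ 0 (mod p)`, via `a^p = a` in `ZMod p`
  have h1 : (p : ℤ) ∣ r + s := by
    rw [← ZMod.intCast_zmod_eq_zero_iff_dvd]
    have ht0 : ((t : ℤ) : ZMod p) = 0 := (ZMod.intCast_zmod_eq_zero_iff_dvd t p).mpr hpt
    have h := congrArg (Int.cast : ℤ → ZMod p) heq
    push_cast at h
    rw [ZMod.pow_card, ZMod.pow_card, ZMod.pow_card, ht0, add_zero] at h
    push_cast
    exact h
  -- `p ∤ r`
  have hpr : ¬ (p : ℤ) ∣ r := by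
    intro h
    have hs : (p : ℤ) ∣ s := by simpa using dvd_sub h1 h
    exact hP.not_unit (hrs.isUnit_of_dvd' h hs)
  -- `p ∣ Q`
  have h2 : (p : ℤ) ∣ powSumQuot p r s := by
    have hsub : (p : ℤ) ∣ r - (-s) := by simpa [sub_neg_eq_add] using h1
    exact (dvd_geom_sum₂_iff_of_dvd_sub hsub).mpr (dvd_mul_right _ _)
  refine ⟨h1, h2, ?_⟩
  -- `p² ∤ Q` by lifting the exponent
  have hlte := Int.emultiplicity_pow_add_pow hp hodd h1 hpr hodd
  have hQne : powSumQuot p r s ≠ 0 := by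
    intro h0; rw [h0, mul_zero] at hprod
    exact ht (neg_eq_zero.mp (pow_eq_zero_iff hodd.pos.ne' |>.mp hprod.symm))
  have hfin1 : FiniteMultiplicity (p : ℤ) (r + s) := Int.finiteMultiplicity_iff.mpr ⟨by simpa using hp.ne_one, hne⟩
  have hfin2 : FiniteMultiplicity (p : ℤ) (powSumQuot p r s) :=
    Int.finiteMultiplicity_iff.mpr ⟨by simpa using hp.ne_one, hQne⟩
  have hfin3 : FiniteMultiplicity p p := Nat.finiteMultiplicity_iff.mpr ⟨hp.ne_one, hp.pos⟩
  rw [← powSumQuot_mul_add hodd r s, mul_comm, emultiplicity_mul hP, hfin1.emultiplicity_eq_multiplicity,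
    hfin2.emultiplicity_eq_multiplicity, hfin3.emultiplicity_eq_multiplicity, multiplicity_self] at hlte
  norm_cast at hlte
  have hm : multiplicity (p : ℤ) (powSumQuot p r s) = 1 := by omega
  rw [hfin2.pow_dvd_iff_le_multiplicity, hm]
  omega

/-! ### Two auxiliary facts for Lemma 5.7 -/

/-- Parity: for odd integers `u, v` and odd `n`, the sum `Σ_{i<n} u^i v^{n−1−i}` (`= (u^n − v^n)/(u − v)`) is odd —
"each term `u^{n−1−i} v^i` is odd" (proof of Lemma 5.7, p. 228–229). [cite: MochizukiEtAl2022, Lemma 5.7 proof p. 228] -/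
theorem odd_geom_sum₂ {n : ℕ} (hn : Odd n) {u v : ℤ} (hu : Odd u) (hv : Odd v) :
    Odd (∑ i ∈ Finset.range n, u ^ i * v ^ (n - 1 - i)) := by
  rw [Int.odd_iff, Finset.sum_int_mod]
  have h1 : ∀ i ∈ Finset.range n, (u ^ i * v ^ (n - 1 - i)) % 2 = 1 :=
    fun i _ => Int.odd_iff.mp ((hu.pow).mul hv.pow)
  rw [Finset.sum_congr rfl h1, Finset.sum_const, Finset.card_range, nsmul_eq_mul, mul_one]
  obtain ⟨k, rfl⟩ := hn
  push_cast
  omega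

/-- `(p + 1)^p < p^{2p−1}` for `p ≥ 3` ("the fact that `γ^{2γ−1} > (γ+1)^γ` for all `γ ∈ ℝ_{≥3}`", proof of
Lemma 5.7, p. 229): `(p+1)^p = p^p (1 + 1/p)^p ≤ e·p^p < 3p^p ≤ p^{p+1} ≤ p^{2p−1}`. PROVED (natural `p`).
[cite: MochizukiEtAl2022, Lemma 5.7 proof p. 229] -/
theorem succ_pow_lt_pow (hp3 : 3 ≤ p) : (p + 1) ^ p < p ^ (2 * p - 1) := by
  have hp0 : (0 : ℝ) < p := by exact_mod_cast (show 0 < p by omega)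
  -- real-number core: `(p+1)^p < 3·p^p`
  have hreal : ((p : ℝ) + 1) ^ p < 3 * (p : ℝ) ^ p := by
    have h1 : ((p : ℝ) + 1) = p * (1 + 1 / p) := by field_simp
    have h2 : (1 + 1 / (p : ℝ)) ^ p ≤ Real.exp 1 := by
      have h := Real.add_one_le_exp (1 / (p : ℝ))
      have h0 : 0 ≤ 1 + 1 / (p : ℝ) := by positivity
      calc (1 + 1 / (p : ℝ)) ^ p ≤ Real.exp (1 / p) ^ p := by
            rw [add_comm] at h; exact pow_le_pow_left₀ h0 h p
        _ = Real.exp 1 := by rw [← Real.exp_nat_mul]; congr 1; field_simp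
    have h3 : Real.exp 1 < 3 := lt_trans Real.exp_one_lt_d9 (by norm_num)
    rw [h1, mul_pow]
    have hpp : 0 < (p : ℝ) ^ p := pow_pos hp0 p
    nlinarith
  have hnat : (p + 1) ^ p < 3 * p ^ p := by exact_mod_cast hreal
  calc (p + 1) ^ p < 3 * p ^ p := hnat
    _ ≤ p * p ^ p := Nat.mul_le_mul_right _ hp3
    _ = p ^ (p + 1) := by ring
    _ ≤ p ^ (2 * p - 1) := Nat.pow_le_pow_right (by omega) (by omega)

end ExpEst

end Literature.IUT.LogVolume
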